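import Summits.ResolutionOfSingularities.ResolutionOfSingularities.Theses.WeightedInvariant
import Summits.ResolutionOfSingularities.ResolutionOfSingularities.Theorems.WeightedInvariantHypersurfaceLocalGameEFT4S
import Summits.ResolutionOfSingularities.ResolutionOfSingularities.Theorems.WeightedInvariantHypersurfaceCentreAssemblyDefs
import Summits.ResolutionOfSingularities.ResolutionOfSingularities.Theorems.WeightedInvariantHypersurfaceGenericPointOffSingImage
import Summits.ResolutionOfSingularities.ResolutionOfSingularities.Theorems.WeightedInvariantWeightedThesisHypersurfaceChoice
import Summits.ResolutionOfSingularities.ResolutionOfSingularities.Theorems.WeightedInvariantHypersurfaceCentreChoiceToDatum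
import Summits.ResolutionOfSingularities.ResolutionOfSingularities.Theorems.WeightedInvariantHypersurfaceCentreAssemblyStubExists
import Summits.ResolutionOfSingularities.ResolutionOfSingularities.Theorems.WeightedInvariantHypersurfaceCentreAssemblyStubRegular
import Summits.ResolutionOfSingularities.ResolutionOfSingularities.Theorems.WeightedInvariantHypersurfaceCentreConstructionStubIsHomogeneous
import Summits.ResolutionOfSingularities.ResolutionOfSingularities.Theorems.WeightedInvariantHypersurfaceCentreAssemblyStubIotaDrop

/-!
# `WeightedInvariant.HypersurfaceCentreConstruction` (stmt-ResolutionOfSingularities-19897): THE DOOR FROM ITS KEY, IN THE TREE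
# — the crux BY NAME from the single registered stub `stub_localWeightedDropEFT4S` (H2a⁗), every other piece a tree theorem

[OURS · route `ResolutionOfSingularities/WeightedInvariant` · DOOR crux `HypersurfaceCentreConstruction` (stmt-ResolutionOfSingularities-19897),
skeleton of record v3.12 `7a4b52ef4f5779aa` (res-L1-w43-plan-1, cell file `L/res-L1-w43-plan-1/door_local_engine_v312.lean`, PART 2 = res-D-brk-1's
door assembly v3).  Candidates of the programme; nothing here is a statement of, or about, any manuscript under adjudication; AI-written, weaker than
expert review; counted 0; proves no summit and closes no registered stub — it PINS the door to its key in the kernel.]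

## What this file does (the skeleton's PART 2 composition, re-run on the LANDED pieces; no definition, no new axiom)

The skeleton's line tier reads: DOOR ⟸ KEY `stub_localWeightedDropEFT4S : ∀ p prime, LocalWeightedDropEFT4S p` + [S1] `stub_maxLocus` + [S2] generic
point off the centre + [S3] `stub_exists_isCanonicalCentre` + [S4] `stub_isRegularWeightedCentre_of_isCanonicalCentre` + [S5]
`stub_isHomogeneous_of_isCanonicalCentre` + [S6] `stub_iotaMax_lt_of_step`, composed by `hypersurfaceCentreChoice_of_clauses` →
`nonempty_hypersurfaceTerminatingCentreDatum_of_choice` (res-type-057's H1).  All of [S1]–[S6] are TREE THEOREMS (p504597 · p501933 · p507446 ·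
p506882 · p503996 · `…StubIotaDrop`), but the composition itself lived only in the cell file.  Here it is, against the tree names:

* `nonempty_hypersurfaceTerminatingCentreDatum_of_eft4S` — `LocalWeightedDropEFT4S p → Nonempty (HypersurfaceTerminatingCentreDatum p)` (the
  centre CHOICE is built inline as an anonymous structure: centre rule `centreRule ι J`, (iii) by [S4]∘[S3], (ii′) by [S2], (H) by [S5]∘[S3],
  termination by [S6] through `InvImage.wf` on `iotaMax`);
* `hypersurfaceCentreConstruction_of_key` — **the crux `Theses.WeightedInvariant.HypersurfaceCentreConstruction` BY NAME from the KEY alone**.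

So the door item rests, in the kernel, on EXACTLY ONE named candidate: `∀ p prime, LocalWeightedDropEFT4S p` (the canonical intrinsic e.f.t. local
weighted game, all Krull dimensions — the open problem proper; its counted rungs are P2 ✓, P3 = `stub_keyRungGrHomLE_three` open with the clause census
`keyRungGrHomLE_three_of_open_clauses` of `…KeyRungThreeOfClauses`, and the E2 tier `stub_e2_centre_h` ⟸ (G-6b) via `stub_e2_centre_h_of_hom`,
`stub_e2_inv_succ_loc_h` open).
-/

noncomputable section

set_option linter.dupNamespace false -- mandated namespace of this single-conjunct summit

open CategoryTheory AlgebraicGeometry TopologicalSpace IsLocalRing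
open Literature.AlgebraicGeometry.Resolution
open Summit.ResolutionOfSingularities.ResolutionOfSingularities.Theorems

namespace Summit.ResolutionOfSingularities.ResolutionOfSingularities.Cruxes.HypersurfaceCentreConstruction.LocalEngine

namespace DoorOfKey

/-- **H2a⁗ at one prime ⇒ the door datum**: `LocalWeightedDropEFT4S p` yields a terminating hypersurface centre datum in characteristic `p`
(the skeleton's `hypersurfaceCentreChoice_of_clauses` + `nonempty_datum_of_eft4`, with [S2]–[S6] the tree theorems). [OURS · door kernel census] -/
theorem nonempty_hypersurfaceTerminatingCentreDatum_of_eft4S {p : ℕ} (h : LocalWeightedDropEFT4S p) :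
    Nonempty (HypersurfaceTerminatingCentreDatum p) := by
  obtain ⟨ι, J, hc6, hc7, hc8, hc10, hJ, hJs, hgame, hopen, hu, hJu⟩ := h
  refine nonempty_hypersurfaceTerminatingCentreDatum_of_choice p
    { centre := fun k _ Y f X => centreRule ι J f X
      isRegularWeightedCentre_centre := fun k _ _ _ Y f _ _ _ X hX hXi hsing =>
        stub_isRegularWeightedCentre_of_isCanonicalCentre ι J hc6 hc8 hu hJ hJu hgame hopen f X hX hXi hsing _
          (centreRule_spec ι J f X (stub_exists_isCanonicalCentre ι J hc6 hc8 hu hJ hJu hgame hopen f X hX hXi hsing))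
      genericPoint_not_mem_support_centre := fun k _ _ _ Y X' f _ _ _ i _ _ hX hsing =>
        apply_genericPoint_not_mem_support_of_support_subset_singImage i _ (support_centreRule_subset_singImage ι J f i.ker)
      centre_isHomogeneous := fun k _ _ _ Y f _ _ _ X hX hXi hsing j W 𝒢 _ h0 hXhom n =>
        stub_isHomogeneous_of_isCanonicalCentre ι J hc6 hu hJ hJu hJs f X hX hXi hsing _
          (centreRule_spec ι J f X (stub_exists_isCanonicalCentre ι J hc6 hc8 hu hJ hJu hgame hopen f X hX hXi hsing))
          W 𝒢 h0 hXhom n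
      wellFounded_step := fun k _ _ _ => by
        refine Subrelation.wf (r := InvImage (· < ·) fun P : HypersurfacePair k => iotaMax ι P.X) ?_
          (InvImage.wf _ wellFounded_lt)
        intro P' P h
        exact stub_iotaMax_lt_of_step ι J hc6 hc7 hc8 hc10 hu hJ hJu hJs hgame hopen _
          (fun Y f _ _ _ X hX hXi hsing =>
            centreRule_spec ι J f X (stub_exists_isCanonicalCentre ι J hc6 hc8 hu hJ hJu hgame hopen f X hX hXi hsing))
          P' P h }
    (fun k _ _ _ Y f _ _ _ X hX hXi hsing => support_centreRule_subset_singImage ι J f X)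

/-- **THE DOOR FROM ITS KEY, BY NAME**: the crux `Theses.WeightedInvariant.HypersurfaceCentreConstruction` (stmt-ResolutionOfSingularities-19897) from
the registered key stub's statement `∀ p prime, LocalWeightedDropEFT4S p` alone. [OURS · door kernel census] -/
theorem hypersurfaceCentreConstruction_of_key (hkey : ∀ p : ℕ, p.Prime → LocalWeightedDropEFT4S p) :
    Summit.ResolutionOfSingularities.ResolutionOfSingularities.Theses.WeightedInvariant.HypersurfaceCentreConstruction := by
  intro p hp
  exact nonempty_hypersurfaceTerminatingCentreDatum_of_eft4S (hkey p hp)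

end DoorOfKey

end Summit.ResolutionOfSingularities.ResolutionOfSingularities.Cruxes.HypersurfaceCentreConstruction.LocalEngine

end
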